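import Summits.BirchSwinnertonDyer.BirchSwinnertonDyer.Theorems.PrintCf2DisegniPairTwoDefectKeyModuloDescent
import Literature.NumberTheory.EllipticCurves.QuadraticTwistAtTwoMinimalModelProofs
import Literature.NumberTheory.EllipticCurves.ManinConstantQuadraticTwistAtTwoOrdinaryProofs
import Literature.NumberTheory.EllipticCurves.GlobalMinimalModel
import HarnessLib

/-!
# Road (C) `disegni-pair-two` on crux stmt-BirchSwinnertonDyer-20368 — the twist scaling at `2` is `|u(C)| = 2`
# (Stevens' `η = 1`, ordinary case), and the defect key of each class MODULO (Δ1) with `v₂(u(C)) = 1` DISCHARGED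

Cell `bsd-print-cf2`, width seat `bsd-line-cf2-p1-w8` g23; sequel of `PrintCf2DisegniPairTwoDefectKeyModuloDescent.lean`.
`--supports stmt-BirchSwinnertonDyer-20368` (helper). THEOREMS ONLY (no `def`, no named fact, no `sorry`); conditional on
every displayed hypothesis. BSD is not proved by any of this; no summit statement is claimed; 20368 is not closed here.

## What is proved

* §1 ★★ `abs_u_eq_two_of_isOrdinaryAt` — `V/ℚ` globally minimal, good ORDINARY at `2`; `W` globally minimal with
  `C • W = V^{(d)}`, `d ∈ {−1, 2, −2}` ⟹ `|u(C)| = 2`. Mechanism: `a₁(V)` is odd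
  (`odd_a₁_of_hasGoodReductionAtPrime_two_of_odd_frobeniusTrace_two`), so the equation `V^{(4d)}` is GLOBALLY MINIMAL
  (`isGloballyMinimal_quadraticTwist_four_mul_of_odd_a₁`: Connell / Pal 2012 Prop. 2.4 at `2`, Stevens 1989 (5.2) `η = 1`,
  Kraus); `V^{(4d)} = (½,0,0,0) • V^{(d)}`; two globally minimal models differ by `u = ±1` (`isGloballyMinimal_unique_holds`).
  `padicValRat_u_eq_one_of_isOrdinaryAt`: hence `v₂(u(C)) = 1` — one class constant of the defect key, discharged.
* §2 ★★★ `defectKey_chi8_modulo_descent_min`, `defectKey_chi4_modulo_descent_min`, `defectKey_chi8'_modulo_descent_min`: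
  the compositions of `…DefectKeyModuloDescent` for a GLOBALLY MINIMAL member `W`, with `v₂(u(C)) = 1` plugged in:
  `v₂(shaAn W) [+ v₂(c_∞(V))] + v₂(Tam W) + v₂(h₂) = v₂(D) + 2 + 2v₂(#W(ℚ)_tors) + v₂(ϖ|μ)`.
  Remaining for the defect key: the (Δ1) law for `v₂(D) − v₂(h₂)` and the newform period-ratio valuation `v₂(ϖ)`/`v₂(μ)`
  of `V` (Manin constant / lattice index), plus `c_∞(V)` on the odd lines.

References: G. Stevens, Invent. Math. 98 (1989) Lemma (5.2) [Stevens1989]; V. Pal, Proc. AMS 140 (2012) Prop. 2.4,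
Thm. 3.2 [Pal2012]; A. Kraus, Acta Arith. 54 (1989) Prop. 2 [Kraus1989]; J. H. Silverman, AEC (2009) VII.1.3, VIII.8
[SilvermanAEC2009]; D. Disegni, Compos. Math. 153 (2017) Thm. B [Disegni2017].
-/

set_option autoImplicit false
set_option linter.dupNamespace false

noncomputable section

open scoped Classical MatrixGroups ModularForm NumberField

open CongruenceSubgroup NumberField IsDedekindDomain WeierstrassCurve WeierstrassCurve.Affine.Point
  Literature.NumberTheory.EllipticCurves Literature.NumberTheory.EllipticCurves.ModularForms
  Literature.NumberTheory.EllipticCurves.Disegni2017 Literature.NumberTheory.GaloisRepresentations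
  Summit.BirchSwinnertonDyer.Rank1Residual.AdditivePotMult

namespace Summit.BirchSwinnertonDyer.BirchSwinnertonDyer.Theorems.PrintCf2.DisegniPairTwo

/-! ### §1 The twist scaling at `2` -/

section Scaling

/-- ★★ **`|u(C)| = 2`** for the change of variables from a globally minimal model `W` of the twist to the twisted
equation `V^{(d)}` (`C • W = V^{(d)}`, `d ∈ {−1, 2, −2}`) of a globally minimal `V` good ORDINARY at `2`: the equation
`V^{(4d)} = (½,0,0,0) • V^{(d)}` is globally minimal (`a₁(V)` odd; Connell / Pal Prop. 2.4, Stevens (5.2) `η = 1`), and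
globally minimal models differ by `u = ±1`. [cite: Pal2012, Prop. 2.4 (case p = 2)] [cite: Stevens1989, Lemma (5.2)]
[cite: SilvermanAEC2009, VIII.8 (remark after Cor. 8.3)] -/
theorem abs_u_eq_two_of_isOrdinaryAt (V W : WeierstrassCurve ℚ) [V.IsElliptic] [V.IsGloballyMinimal]
    [W.IsElliptic] [W.IsGloballyMinimal] (hordV : IsOrdinaryAt V 2) {d : ℤ} (hd : d = -1 ∨ d = 2 ∨ d = -2)
    {C : VariableChange ℚ} (hC : C • W = V.quadraticTwist (d : ℚ)) : |(C.u : ℚ)| = 2 := by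
  -- `a₁(V)` odd, so `V^{(4d)}` is globally minimal
  have hodd : Odd (V.frobeniusTrace 2) :=
    Int.not_even_iff_odd.mp fun h ↦ hordV.2 (by exact_mod_cast even_iff_two_dvd.mp h)
  have ha₁ : Odd (integralModelInt V).a₁ :=
    odd_a₁_of_hasGoodReductionAtPrime_two_of_odd_frobeniusTrace_two V hordV.1 hodd
  have hmin : (V.quadraticTwist (4 * (d : ℚ))).IsGloballyMinimal :=
    isGloballyMinimal_quadraticTwist_four_mul_of_odd_a₁ V hd ha₁
  -- the scaling `C₂ = (½, 0, 0, 0)`: `C₂ • V^{(d)} = V^{(4d)}`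
  set C₂ : VariableChange ℚ := ⟨(Units.mk0 (2 : ℚ) two_ne_zero)⁻¹, 0, 0, 0⟩ with hC₂
  have hC₂V : C₂ • V.quadraticTwist (d : ℚ) = V.quadraticTwist (4 * (d : ℚ)) := by
    rw [show (4 : ℚ) * d = d * 2 ^ 2 by ring]
    ext
    · simp [hC₂, variableChange_a₁]
    · simp only [hC₂, variableChange_a₂, quadraticTwist_a₂, quadraticTwist_a₁, inv_inv, Units.val_mk0]
      ring
    · simp [hC₂, variableChange_a₃]
    · simp only [hC₂, variableChange_a₄, quadraticTwist_a₁, quadraticTwist_a₂, quadraticTwist_a₃,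
        quadraticTwist_a₄, inv_inv, Units.val_mk0]
      ring
    · simp only [hC₂, variableChange_a₆, quadraticTwist_a₁, quadraticTwist_a₂, quadraticTwist_a₃,
        quadraticTwist_a₄, quadraticTwist_a₆, inv_inv, Units.val_mk0]
      ring
  have hCC : (C₂ * C) • W = V.quadraticTwist (4 * (d : ℚ)) := by rw [mul_smul, hC, hC₂V]
  haveI : ((C₂ * C) • W).IsGloballyMinimal := by rw [hCC]; exact hmin
  obtain ⟨hu, -⟩ := isGloballyMinimal_unique_holds W (C₂ * C)
  have hmul : (((C₂ * C).u : ℚˣ) : ℚ) = 2⁻¹ * (C.u : ℚ) := by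
    rw [show (C₂ * C).u = C₂.u * C.u from rfl, Units.val_mul, hC₂, Units.val_inv_eq_inv_val, Units.val_mk0]
  rcases hu with h | h
  · have h' : 2⁻¹ * (C.u : ℚ) = 1 := by rw [← hmul, h, Units.val_one]
    rw [show (C.u : ℚ) = 2 by linarith, abs_of_pos (by norm_num : (0 : ℚ) < 2)]
  · have h' : 2⁻¹ * (C.u : ℚ) = -1 := by rw [← hmul, h, Units.val_neg, Units.val_one]
    rw [show (C.u : ℚ) = -2 by linarith, abs_neg, abs_of_pos (by norm_num : (0 : ℚ) < 2)]

/-- **`v₂(u(C)) = 1`** in the situation of `abs_u_eq_two_of_isOrdinaryAt` (`|u(C)| = 2`). [cite: Pal2012, Prop. 2.4 (p = 2)] -/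
theorem padicValRat_u_eq_one_of_isOrdinaryAt (V W : WeierstrassCurve ℚ) [V.IsElliptic] [V.IsGloballyMinimal]
    [W.IsElliptic] [W.IsGloballyMinimal] (hordV : IsOrdinaryAt V 2) {d : ℤ} (hd : d = -1 ∨ d = 2 ∨ d = -2)
    {C : VariableChange ℚ} (hC : C • W = V.quadraticTwist (d : ℚ)) : padicValRat 2 (C.u : ℚ) = 1 := by
  have habs := abs_u_eq_two_of_isOrdinaryAt V W hordV hd hC
  have h2v : padicValRat 2 (2 : ℚ) = 1 := by
    rw [show (2 : ℚ) = ((2 : ℕ) : ℚ) by norm_num, padicValRat.of_nat, padicValNat_self]; rfl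
  rcases abs_choice (C.u : ℚ) with h | h
  · rw [← h, habs, h2v]
  · have h2 : -(C.u : ℚ) = 2 := by rw [← h]; exact habs
    rw [show (C.u : ℚ) = -2 by linarith, padicValRat.neg, h2v]

end Scaling

variable (ι : PadicAlgCl 2 ≃+* ℂ) (K : Type) [Field K] [NumberField K] [IsGalois ℚ K]

/-! ### §2 The defect key of each class MODULO (Δ1), for a globally minimal member -/

/-- ★★★ **The defect key of the `χ₈∘N`-class MODULO (Δ1) for a GLOBALLY MINIMAL member `W`**: as
`defectKey_chi8_modulo_descent` with `v₂(u(C)) = 1` discharged (`padicValRat_u_eq_one_of_isOrdinaryAt`):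
`v₂(q) + v₂(Tam W) + v₂(h₂) = v₂(D) + 2 + 2v₂(#W(ℚ)_tors) + v₂(ϖ)`.
[cite: Disegni2017, Theorem B] [cite: Pal2012, Prop. 2.4, Thm. 3.2] [cite: Stevens1989, Lemma (5.2)] -/
theorem defectKey_chi8_modulo_descent_min (hGZ73 : GrossZagier1986_thm_I_7_3) (h2 : Module.finrank ℚ K = 2)
    (hsplit : ((Ideal.span {(2 : ℤ)}).primesOver (𝓞 K)).ncard = 2)
    (𝔭 𝔭' : HeightOneSpectrum (𝓞 K)) (h𝔭 : ((2 : ℕ) : 𝓞 K) ∈ 𝔭.asIdeal)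
    (h𝔭' : ((2 : ℕ) : 𝓞 K) ∈ 𝔭'.asIdeal)
    (κ : DirichletCharacter ℂ (NumberField.discr K).natAbs)
    (hκ : ∀ ℓ : ℕ, ℓ.Prime → ℓ ≠ 2 → κ ℓ = (jacobiSym (NumberField.discr K) ℓ : ℂ))
    (hκ2 : κ 2 = if NumberField.discr K % 8 = 1 then 1 else if NumberField.discr K % 8 = 5 then -1 else 0)
    (hd : Nat.Coprime 2 (NumberField.discr K).natAbs)
    -- the good pair
    (V V' : WeierstrassCurve ℚ) [V.IsElliptic] [V.IsGloballyMinimal] [V'.IsElliptic] [V'.IsGloballyMinimal]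
    (hordV : IsOrdinaryAt V 2) (hordV' : IsOrdinaryAt V' 2) (hap : V'.frobeniusTrace 2 = V.frobeniusTrace 2)
    {N N' : ℕ} [NeZero N] [NeZero N'] (hN : ¬ 2 ∣ N) {f : CuspForm (Gamma0 N) 2}
    {f' : CuspForm (Gamma0 N') 2} (hfV : IsNewformOf V f) (hfV' : IsNewformOf V' f')
    (hV' : ∀ n : ℕ, cuspCoeff f' n = κ (n : ZMod _) * cuspCoeff f n)
    (h0 : HasSum (fun k : ℕ ↦ PowerSeries.coeff k (padicLFunction f (unitRoot V 2 : ℚ_[2])) *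
      (-2 : ℚ_[2]) ^ k) 0)
    -- the member (analytic rank one, rank one) and its companion
    (hmod : hasEntireLFunction_rat) {M M' : ℕ} [NeZero M] [NeZero M']
    {g : CuspForm (Gamma0 M) 2} {g' : CuspForm (Gamma0 M') 2}
    (W W' : WeierstrassCurve ℚ) [W.IsElliptic] [W.IsGloballyMinimal] [W'.IsElliptic]
    (hg : IsNewformOf W g) (hg' : IsNewformOf W' g')
    (hgε : ∀ m : ℕ, cuspCoeff g m = (ZMod.χ₈.ringHomComp (Int.castRingHom ℂ)) m * cuspCoeff f m)
    (hg'ε : ∀ m : ℕ, cuspCoeff g' m = (ZMod.χ₈.ringHomComp (Int.castRingHom ℂ)) m * cuspCoeff f' m)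
    (hr : W.analyticRank = 1) (hrk : W.mordellWeilRank = 1) (hL' : W'.entireLFunction 1 ≠ 0)
    -- the tower frame and the sign character
    {H : Type} [Field H] [NumberField H] [Algebra K H] (hKH : Module.finrank K H = 2) {t : H}
    (htK : t ∉ Set.range (algebraMap K H)) (ht2 : t ^ 2 = algebraMap ℚ H 2)
    (G : Subgroup (H ≃ₐ[ℚ] H)) (χ : G →* ℂˣ) (s : G → ℤ) (hs : ∀ σ, ((χ σ : ℂˣ) : ℂ) = (s σ : ℂ))
    (τ : H ≃ₐ[ℚ] H) (hτG : τ ∈ G) (hsτ : s ⟨τ, hτG⟩ = -1)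
    (hτK : ∀ a : K, τ (algebraMap K H a) = algebraMap K H a) (hτt : τ t = -t)
    {u : K} {e : ℚ} (hu : u ∉ Set.range (algebraMap ℚ K)) (hue : u ^ 2 = algebraMap ℚ K e)
    (c : K ≃ₐ[ℚ] K) (hcu : c u = -u)
    -- the member's explicit model `V^{(2)} = C • W` and its Mordell–Weil generator
    [(V.quadraticTwist 2).IsElliptic] {C : VariableChange ℚ} (hC : C • W = V.quadraticTwist 2)
    {P : (V.quadraticTwist 2).toAffine.Point}
    (hgen : ∀ R : (V.quadraticTwist 2).toAffine.Point,
      ∃ (k : ℤ) (T : (V.quadraticTwist 2).toAffine.Point), IsOfFinAddOrder T ∧ R = k • P + T)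
    (htors : ∀ Q : ((V.quadraticTwist 2).quadraticTwist e).toAffine.Point, IsOfFinAddOrder Q)
    -- Disegni's datum: invariance, PIN, and the conjoined clauses (PRINT stub of the road)
    (DH : PAdicHeightDataK V 2 H)
    (hDH : ∀ (σ : G) (a b : (V.baseChange H).toAffine.Point),
      DH.pairing (pointGalHom V H σ.1 a) (pointGalHom V H σ.1 b) = DH.pairing a b)
    {h₂ : ℚ_[2]}
    (hpin : DH.pairing
      (twistPointEquivOver V (not_mem_range_rat_of_not_mem_range htK) ht2
        (QuadraticDescent.incl H (V.quadraticTwist 2) P))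
      (twistPointEquivOver V (not_mem_range_rat_of_not_mem_range htK) ht2
        (QuadraticDescent.incl H (V.quadraticTwist 2) P)) = h₂)
    (hGZ : ChiLineGrossZagierClauses ι K V H f (ι (((unitRoot V 2 : ℚ_[2]) : PadicAlgCl 2)))
      (baseChangeDirichlet K (ZMod.χ₈.ringHomComp (Int.castRingHom ℂ))) 𝔭 𝔭' G χ DH)
    -- the plus period ratio of `V` (Manin constant / lattice index; from a ModularParametrizationData)
    {ϖ : ℚ} (hϖ0 : ϖ ≠ 0) (hϖ : (ϖ : ℝ) * V.realPeriodRat = plusPeriod f)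
    -- Bertrand: the 2-adic height of the member's generator is non-zero
    (hh₂ : h₂ ≠ 0) :
    (∑' k : ℕ, PowerSeries.coeff k (padicLFunction f (unitRoot V 2 : ℚ_[2])) * (k : ℚ_[2]) *
        (-2) ^ (k - 1)) ≠ 0 ∧
    ∃ q : ℚ, shaAn W = (q : ℂ) ∧ q ≠ 0 ∧
      padicValRat 2 q + (padicValNat 2 W.tamagawaProduct : ℤ) + h₂.valuation =
        ((∑' k : ℕ, PowerSeries.coeff k (padicLFunction f (unitRoot V 2 : ℚ_[2])) * (k : ℚ_[2]) *
        (-2) ^ (k - 1))).valuation + 2 +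
          2 * (padicValNat 2 W.torsionOrder : ℤ) + padicValRat 2 ϖ := by
  obtain ⟨hD, q, hq, hq0, hv⟩ := defectKey_chi8_modulo_descent ι K hGZ73 h2 hsplit 𝔭 𝔭' h𝔭 h𝔭' κ hκ hκ2 hd V V' hordV hordV' hap hN hfV
    hfV' hV' h0 hmod W W' hg hg' hgε hg'ε hr hrk hL' hKH htK ht2 G χ s hs τ hτG hsτ hτK hτt hu hue c hcu hC hgen
    htors DH hDH hpin hGZ hϖ0 hϖ hh₂
  have hu : padicValRat 2 (C.u : ℚ) = 1 :=
    padicValRat_u_eq_one_of_isOrdinaryAt V W hordV (d := 2) (by norm_num) (by rw [hC]; norm_num)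
  refine ⟨hD, q, hq, hq0, ?_⟩
  rw [hu] at hv
  linear_combination hv

/-- ★★★ **The defect key of the `χ₋₄∘N`-class MODULO (Δ1) for a GLOBALLY MINIMAL member `W`**: as
`defectKey_chi4_modulo_descent` with `v₂(u(C)) = 1` discharged (`padicValRat_u_eq_one_of_isOrdinaryAt`):
`v₂(q) + v₂(c_∞(V)) + v₂(Tam W) + v₂(h₂) = v₂(D) + 2 + 2v₂(#W(ℚ)_tors) + v₂(μ)`.
[cite: Disegni2017, Theorem B] [cite: Pal2012, Prop. 2.4, Thm. 3.2] [cite: Stevens1989, Lemma (5.2)] -/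
theorem defectKey_chi4_modulo_descent_min (hGZ73 : GrossZagier1986_thm_I_7_3) (h2 : Module.finrank ℚ K = 2)
    (hsplit : ((Ideal.span {(2 : ℤ)}).primesOver (𝓞 K)).ncard = 2)
    (𝔭 𝔭' : HeightOneSpectrum (𝓞 K)) (h𝔭 : ((2 : ℕ) : 𝓞 K) ∈ 𝔭.asIdeal)
    (h𝔭' : ((2 : ℕ) : 𝓞 K) ∈ 𝔭'.asIdeal)
    (κ : DirichletCharacter ℂ (NumberField.discr K).natAbs)
    (hκ : ∀ ℓ : ℕ, ℓ.Prime → ℓ ≠ 2 → κ ℓ = (jacobiSym (NumberField.discr K) ℓ : ℂ))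
    (hκ2 : κ 2 = if NumberField.discr K % 8 = 1 then 1 else if NumberField.discr K % 8 = 5 then -1 else 0)
    (hd : Nat.Coprime 2 (NumberField.discr K).natAbs)
    (V V' : WeierstrassCurve ℚ) [V.IsElliptic] [V.IsGloballyMinimal] [V'.IsElliptic] [V'.IsGloballyMinimal]
    (hordV : IsOrdinaryAt V 2) (hordV' : IsOrdinaryAt V' 2) (hap : V'.frobeniusTrace 2 = V.frobeniusTrace 2)
    {N N' : ℕ} [NeZero N] [NeZero N'] {f : CuspForm (Gamma0 N) 2}
    {f' : CuspForm (Gamma0 N') 2} (hfV : IsNewformOf V f) (hfV' : IsNewformOf V' f')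
    (hV' : ∀ n : ℕ, cuspCoeff f' n = κ (n : ZMod _) * cuspCoeff f n)
    (h0 : PowerSeries.constantCoeff (padicLFunctionMinusBranch f (unitRoot V 2 : ℚ_[2]) 1) = 0)
    (hmod : hasEntireLFunction_rat) {M M' : ℕ} [NeZero M] [NeZero M']
    {g : CuspForm (Gamma0 M) 2} {g' : CuspForm (Gamma0 M') 2}
    (W W' : WeierstrassCurve ℚ) [W.IsElliptic] [W.IsGloballyMinimal] [W'.IsElliptic]
    (hg : IsNewformOf W g) (hg' : IsNewformOf W' g')
    (hgε : ∀ m : ℕ, cuspCoeff g m = (ZMod.χ₄.ringHomComp (Int.castRingHom ℂ)) m * cuspCoeff f m)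
    (hg'ε : ∀ m : ℕ, cuspCoeff g' m = (ZMod.χ₄.ringHomComp (Int.castRingHom ℂ)) m * cuspCoeff f' m)
    (hr : W.analyticRank = 1) (hrk : W.mordellWeilRank = 1) (hL' : W'.entireLFunction 1 ≠ 0)
    {H : Type} [Field H] [NumberField H] [Algebra K H] (hKH : Module.finrank K H = 2) {t : H}
    (htK : t ∉ Set.range (algebraMap K H)) (ht2 : t ^ 2 = algebraMap ℚ H (-1))
    (G : Subgroup (H ≃ₐ[ℚ] H)) (χ : G →* ℂˣ) (s : G → ℤ) (hs : ∀ σ, ((χ σ : ℂˣ) : ℂ) = (s σ : ℂ))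
    (τ : H ≃ₐ[ℚ] H) (hτG : τ ∈ G) (hsτ : s ⟨τ, hτG⟩ = -1)
    (hτK : ∀ a : K, τ (algebraMap K H a) = algebraMap K H a) (hτt : τ t = -t)
    {u : K} {e : ℚ} (hu : u ∉ Set.range (algebraMap ℚ K)) (hue : u ^ 2 = algebraMap ℚ K e)
    (c : K ≃ₐ[ℚ] K) (hcu : c u = -u)
    [(V.quadraticTwist (-1)).IsElliptic] {C : VariableChange ℚ} (hC : C • W = V.quadraticTwist (-1))
    {P : (V.quadraticTwist (-1)).toAffine.Point}
    (hgen : ∀ R : (V.quadraticTwist (-1)).toAffine.Point,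
      ∃ (k : ℤ) (T : (V.quadraticTwist (-1)).toAffine.Point), IsOfFinAddOrder T ∧ R = k • P + T)
    (htors : ∀ Q : ((V.quadraticTwist (-1)).quadraticTwist e).toAffine.Point, IsOfFinAddOrder Q)
    (DH : PAdicHeightDataK V 2 H)
    (hDH : ∀ (σ : G) (a b : (V.baseChange H).toAffine.Point),
      DH.pairing (pointGalHom V H σ.1 a) (pointGalHom V H σ.1 b) = DH.pairing a b)
    {h₂ : ℚ_[2]}
    (hpin : DH.pairing
      (twistPointEquivOver V (not_mem_range_rat_of_not_mem_range htK) ht2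
        (QuadraticDescent.incl H (V.quadraticTwist (-1)) P))
      (twistPointEquivOver V (not_mem_range_rat_of_not_mem_range htK) ht2
        (QuadraticDescent.incl H (V.quadraticTwist (-1)) P)) = h₂)
    (hGZ : ChiLineGrossZagierClauses ι K V H f (ι (((unitRoot V 2 : ℚ_[2]) : PadicAlgCl 2)))
      (baseChangeDirichlet K (ZMod.χ₄.ringHomComp (Int.castRingHom ℂ))) 𝔭 𝔭' G χ DH)
    -- the minus period ratio of `V` (Manin constant / lattice index; from a ModularParametrizationData)
    {μ : ℚ} (hμ0 : μ ≠ 0) (hμ : (μ : ℝ) * V.imaginaryPeriodRat = minusPeriod f)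
    -- Bertrand: the 2-adic height of the member's generator is non-zero
    (hh₂ : h₂ ≠ 0) :
    (PowerSeries.coeff 1 (padicLFunctionMinusBranch f (unitRoot V 2 : ℚ_[2]) 1)) ≠ 0 ∧
    ∃ q : ℚ, shaAn W = (q : ℂ) ∧ q ≠ 0 ∧
      padicValRat 2 q + (padicValNat 2 (V.baseChange ℝ).numRealComponents : ℤ) + (padicValNat 2 W.tamagawaProduct : ℤ) + h₂.valuation =
        ((PowerSeries.coeff 1 (padicLFunctionMinusBranch f (unitRoot V 2 : ℚ_[2]) 1))).valuation + 2 +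
          2 * (padicValNat 2 W.torsionOrder : ℤ) + padicValRat 2 μ := by
  obtain ⟨hD, q, hq, hq0, hv⟩ := defectKey_chi4_modulo_descent ι K hGZ73 h2 hsplit 𝔭 𝔭' h𝔭 h𝔭' κ hκ hκ2 hd V V' hordV hordV' hap hfV
    hfV' hV' h0 hmod W W' hg hg' hgε hg'ε hr hrk hL' hKH htK ht2 G χ s hs τ hτG hsτ hτK hτt hu hue c hcu hC hgen
    htors DH hDH hpin hGZ hμ0 hμ hh₂
  have hu : padicValRat 2 (C.u : ℚ) = 1 :=
    padicValRat_u_eq_one_of_isOrdinaryAt V W hordV (d := -1) (by norm_num) (by rw [hC]; norm_num)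
  refine ⟨hD, q, hq, hq0, ?_⟩
  rw [hu] at hv
  linear_combination hv

/-- ★★★ **The defect key of the `χ₋₈∘N`-class MODULO (Δ1) for a GLOBALLY MINIMAL member `W`**: as
`defectKey_chi8'_modulo_descent` with `v₂(u(C)) = 1` discharged (`padicValRat_u_eq_one_of_isOrdinaryAt`):
`v₂(q) + v₂(c_∞(V)) + v₂(Tam W) + v₂(h₂) = v₂(D) + 2 + 2v₂(#W(ℚ)_tors) + v₂(μ)`.
[cite: Disegni2017, Theorem B] [cite: Pal2012, Prop. 2.4, Thm. 3.2] [cite: Stevens1989, Lemma (5.2)] -/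
theorem defectKey_chi8'_modulo_descent_min (hGZ73 : GrossZagier1986_thm_I_7_3) (h2 : Module.finrank ℚ K = 2)
    (hsplit : ((Ideal.span {(2 : ℤ)}).primesOver (𝓞 K)).ncard = 2)
    (𝔭 𝔭' : HeightOneSpectrum (𝓞 K)) (h𝔭 : ((2 : ℕ) : 𝓞 K) ∈ 𝔭.asIdeal)
    (h𝔭' : ((2 : ℕ) : 𝓞 K) ∈ 𝔭'.asIdeal)
    (κ : DirichletCharacter ℂ (NumberField.discr K).natAbs)
    (hκ : ∀ ℓ : ℕ, ℓ.Prime → ℓ ≠ 2 → κ ℓ = (jacobiSym (NumberField.discr K) ℓ : ℂ))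
    (hκ2 : κ 2 = if NumberField.discr K % 8 = 1 then 1 else if NumberField.discr K % 8 = 5 then -1 else 0)
    (hd : Nat.Coprime 2 (NumberField.discr K).natAbs)
    (V V' : WeierstrassCurve ℚ) [V.IsElliptic] [V.IsGloballyMinimal] [V'.IsElliptic] [V'.IsGloballyMinimal]
    (hordV : IsOrdinaryAt V 2) (hordV' : IsOrdinaryAt V' 2) (hap : V'.frobeniusTrace 2 = V.frobeniusTrace 2)
    {N N' : ℕ} [NeZero N] [NeZero N'] {f : CuspForm (Gamma0 N) 2}
    {f' : CuspForm (Gamma0 N') 2} (hfV : IsNewformOf V f) (hfV' : IsNewformOf V' f')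
    (hV' : ∀ n : ℕ, cuspCoeff f' n = κ (n : ZMod _) * cuspCoeff f n)
    (h0 : HasSum (fun k : ℕ ↦ PowerSeries.coeff k (padicLFunctionMinusBranch f (unitRoot V 2 : ℚ_[2]) 1) *
      (-2 : ℚ_[2]) ^ k) 0)
    (hmod : hasEntireLFunction_rat) {M M' : ℕ} [NeZero M] [NeZero M']
    {g : CuspForm (Gamma0 M) 2} {g' : CuspForm (Gamma0 M') 2}
    (W W' : WeierstrassCurve ℚ) [W.IsElliptic] [W.IsGloballyMinimal] [W'.IsElliptic]
    (hg : IsNewformOf W g) (hg' : IsNewformOf W' g')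
    (hgε : ∀ m : ℕ, cuspCoeff g m = (ZMod.χ₈'.ringHomComp (Int.castRingHom ℂ)) m * cuspCoeff f m)
    (hg'ε : ∀ m : ℕ, cuspCoeff g' m = (ZMod.χ₈'.ringHomComp (Int.castRingHom ℂ)) m * cuspCoeff f' m)
    (hr : W.analyticRank = 1) (hrk : W.mordellWeilRank = 1) (hL' : W'.entireLFunction 1 ≠ 0)
    {H : Type} [Field H] [NumberField H] [Algebra K H] (hKH : Module.finrank K H = 2) {t : H}
    (htK : t ∉ Set.range (algebraMap K H)) (ht2 : t ^ 2 = algebraMap ℚ H (-2))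
    (G : Subgroup (H ≃ₐ[ℚ] H)) (χ : G →* ℂˣ) (s : G → ℤ) (hs : ∀ σ, ((χ σ : ℂˣ) : ℂ) = (s σ : ℂ))
    (τ : H ≃ₐ[ℚ] H) (hτG : τ ∈ G) (hsτ : s ⟨τ, hτG⟩ = -1)
    (hτK : ∀ a : K, τ (algebraMap K H a) = algebraMap K H a) (hτt : τ t = -t)
    {u : K} {e : ℚ} (hu : u ∉ Set.range (algebraMap ℚ K)) (hue : u ^ 2 = algebraMap ℚ K e)
    (c : K ≃ₐ[ℚ] K) (hcu : c u = -u)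
    [(V.quadraticTwist (-2)).IsElliptic] {C : VariableChange ℚ} (hC : C • W = V.quadraticTwist (-2))
    {P : (V.quadraticTwist (-2)).toAffine.Point}
    (hgen : ∀ R : (V.quadraticTwist (-2)).toAffine.Point,
      ∃ (k : ℤ) (T : (V.quadraticTwist (-2)).toAffine.Point), IsOfFinAddOrder T ∧ R = k • P + T)
    (htors : ∀ Q : ((V.quadraticTwist (-2)).quadraticTwist e).toAffine.Point, IsOfFinAddOrder Q)
    (DH : PAdicHeightDataK V 2 H)
    (hDH : ∀ (σ : G) (a b : (V.baseChange H).toAffine.Point),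
      DH.pairing (pointGalHom V H σ.1 a) (pointGalHom V H σ.1 b) = DH.pairing a b)
    {h₂ : ℚ_[2]}
    (hpin : DH.pairing
      (twistPointEquivOver V (not_mem_range_rat_of_not_mem_range htK) ht2
        (QuadraticDescent.incl H (V.quadraticTwist (-2)) P))
      (twistPointEquivOver V (not_mem_range_rat_of_not_mem_range htK) ht2
        (QuadraticDescent.incl H (V.quadraticTwist (-2)) P)) = h₂)
    (hGZ : ChiLineGrossZagierClauses ι K V H f (ι (((unitRoot V 2 : ℚ_[2]) : PadicAlgCl 2)))
      (baseChangeDirichlet K (ZMod.χ₈'.ringHomComp (Int.castRingHom ℂ))) 𝔭 𝔭' G χ DH)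
    -- the minus period ratio of `V` (Manin constant / lattice index; from a ModularParametrizationData)
    {μ : ℚ} (hμ0 : μ ≠ 0) (hμ : (μ : ℝ) * V.imaginaryPeriodRat = minusPeriod f)
    -- Bertrand: the 2-adic height of the member's generator is non-zero
    (hh₂ : h₂ ≠ 0) :
    (∑' k : ℕ, PowerSeries.coeff k
        (padicLFunctionMinusBranch f (unitRoot V 2 : ℚ_[2]) 1) * (k : ℚ_[2]) * (-2) ^ (k - 1)) ≠ 0 ∧
    ∃ q : ℚ, shaAn W = (q : ℂ) ∧ q ≠ 0 ∧
      padicValRat 2 q + (padicValNat 2 (V.baseChange ℝ).numRealComponents : ℤ) + (padicValNat 2 W.tamagawaProduct : ℤ) + h₂.valuation =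
        ((∑' k : ℕ, PowerSeries.coeff k
        (padicLFunctionMinusBranch f (unitRoot V 2 : ℚ_[2]) 1) * (k : ℚ_[2]) * (-2) ^ (k - 1))).valuation + 2 +
          2 * (padicValNat 2 W.torsionOrder : ℤ) + padicValRat 2 μ := by
  obtain ⟨hD, q, hq, hq0, hv⟩ := defectKey_chi8'_modulo_descent ι K hGZ73 h2 hsplit 𝔭 𝔭' h𝔭 h𝔭' κ hκ hκ2 hd V V' hordV hordV' hap hfV
    hfV' hV' h0 hmod W W' hg hg' hgε hg'ε hr hrk hL' hKH htK ht2 G χ s hs τ hτG hsτ hτK hτt hu hue c hcu hC hgen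
    htors DH hDH hpin hGZ hμ0 hμ hh₂
  have hu : padicValRat 2 (C.u : ℚ) = 1 :=
    padicValRat_u_eq_one_of_isOrdinaryAt V W hordV (d := -2) (by norm_num) (by rw [hC]; norm_num)
  refine ⟨hD, q, hq, hq0, ?_⟩
  rw [hu] at hv
  linear_combination hv

end Summit.BirchSwinnertonDyer.BirchSwinnertonDyer.Theorems.PrintCf2.DisegniPairTwo

end
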